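import Literature.Geometry.DiscreteGeometry.ShellCensusReplay
import HarnessLib

/-!
# Soundness of the census checker

Topic `Literature/Geometry/DiscreteGeometry`; part 3 of 4 of the replayer for the gapped-shell
census (request `defn-ShellCensusReplay`; data and checker in `ShellCensusReplay.lean`). One lemma
per rule, then the induction:

* `nodeClaim_case` (the admissibility alternative bond/far), `claim_mono` and `claim_of_relabel`
  (rule `ref`: an established claim, relabelled by a permutation, implies every claim with MORE
  constraints), `claim_of_fclaim_rootBox` (rule `frame`: by `exists_frame` every admissible tuple
  has an isometric copy in the root box, and goodness is isometry-invariant), `fclaim_split`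
  (`Box.mem_split`), `fclaim_of_witness` (rule `empty`: each exclusion test contradicts
  admissibility / the constraints through the inclusion property of `sqNormIv`, `sqDistIv`),
  `fclaim_of_accept` (rule `accept`: inclusion property of `sqDistPtIv`, the exactly orthogonal
  matrix as an isometry `rotIso`, and the `eps`-accuracy of the anchors, `eta − eps + eps = eta`);
* `Tree.check_sound`, `Census.checkFrom_sound`, **`Census.check_sound`**
  (`Census.check P C = true → P.Claim Q []` for ANY exact patterns `Q` matching the anchors);
* composition across files: `Census.ctx`, `Census.claims_append_of_checkFrom`,
  `Spec.claim_nil_of_claims`; `Spec.Patterns.injective_of_sep` (patterns whose anchors pass the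
  decidable separation test `anchorsSepB` are injective tuples).

## References
* R. E. Moore, *Interval Analysis* (1966), Theorem 3.1, §4.4. [cite: Moore1966, Theorem 3.1, §4.4]
-/

noncomputable section

namespace Literature.Geometry.DiscreteGeometry

open Literature.Analysis.ValidatedNumerics NonemptyInterval Finset

/-- Euclidean `3`-space. -/
local notation "E3" => EuclideanSpace ℝ (Fin 3)

namespace ShellCensus

/-! ### Soundness of the rules -/

namespace Spec

variable {P : Spec}

/-- Claim of a framed node: every admissible configuration in the box satisfying the
constraints is good. [folklore] -/
def FClaim (P : Spec) (Q : P.Patterns) (S : List Constraint) (B : Box) : Prop :=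
  ∀ t : Fin P.n → E3, P.Admissible t → P.Sat S t → B.mem (flat t) → P.Good Q t

/-- The claim of a node of the search (frame-free or framed). [folklore] -/
def NodeClaim (P : Spec) (Q : P.Patterns) (S : List Constraint) : Option Box → Prop
  | none => P.Claim Q S
  | some B => P.FClaim Q S B

/-- Unpacking `okB`. [folklore] -/
theorem okB_iff : P.okB = true ↔
    0 ≤ P.rlo ∧ 0 ≤ P.dlo ∧ 0 ≤ P.gap ∧ 0 ≤ P.eps ∧ P.eps ≤ P.eta ∧ 3 ≤ P.n := by
  simp [okB, Bool.and_eq_true, decide_eq_true_eq, and_assoc]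

/-- `Sat` of a cons. [folklore] -/
theorem sat_cons {c : Constraint} {S : List Constraint} {t : Fin P.n → E3} :
    P.Sat (c :: S) t ↔
      (∀ (hk : c.1 < P.n) (hl : c.2.1 < P.n),
        (c.2.2 = true → dist (t ⟨c.1, hk⟩) (t ⟨c.2.1, hl⟩) ≤ (P.dhi : ℝ)) ∧
        (c.2.2 = false → (P.gap : ℝ) ≤ dist (t ⟨c.1, hk⟩) (t ⟨c.2.1, hl⟩))) ∧ P.Sat S t := by
  simp only [Sat, List.forall_mem_cons]

/-- **Rule `case`.** [folklore] -/
theorem nodeClaim_case {Q : P.Patterns} {S : List Constraint} {ob : Option Box} {k l : ℕ}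
    (hk : k < P.n) (hl : l < P.n) (hkl : k ≠ l)
    (hb : P.NodeClaim Q ((k, l, true) :: S) ob) (hf : P.NodeClaim Q ((k, l, false) :: S) ob) :
    P.NodeClaim Q S ob := by
  have key : ∀ t, P.Admissible t → P.Sat S t →
      P.Sat ((k, l, true) :: S) t ∨ P.Sat ((k, l, false) :: S) t := by
    intro t ht hS
    rcases ht.dist_alt ⟨k, hk⟩ ⟨l, hl⟩ (fun h => hkl (congrArg Fin.val h)) with h | h
    · exact Or.inl (sat_cons.2 ⟨fun _ _ => ⟨fun _ => h, fun h' => by simp at h'⟩, hS⟩)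
    · exact Or.inr (sat_cons.2 ⟨fun _ _ => ⟨fun h' => by simp at h', fun _ => h⟩, hS⟩)
  cases ob with
  | none =>
    intro t ht hS
    rcases key t ht hS with h | h
    · exact hb t ht h
    · exact hf t ht h
  | some B =>
    intro t ht hS hB
    rcases key t ht hS with h | h
    · exact hb t ht h hB
    · exact hf t ht h hB

/-- **Monotonicity**: more constraints, weaker claim. [folklore] -/
theorem claim_mono {Q : P.Patterns} {S S' : List Constraint} (hsub : ∀ c ∈ S, c ∈ S')
    (h : P.Claim Q S) : P.Claim Q S' :=
  fun t ht hS' => h t ht fun c hc => hS' c (hsub c hc)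

/-- `Good` is invariant under relabelling by a permutation. [folklore] -/
theorem good_of_comp_perm {Q : P.Patterns} {t : Fin P.n → E3} (σ : Equiv.Perm (Fin P.n))
    (h : P.Good Q (t ∘ σ)) : P.Good Q t := by
  obtain ⟨i, hi, hc⟩ := h
  exact ⟨i, hi, hc.of_comp_perm σ⟩

/-- `Good` is invariant under linear isometries. [folklore] -/
theorem good_of_isometry_comp {Q : P.Patterns} {t : Fin P.n → E3} (B : E3 ≃ₗᵢ[ℝ] E3)
    (h : P.Good Q fun k => B (t k)) : P.Good Q t := by
  obtain ⟨i, hi, hc⟩ := h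
  exact ⟨i, hi, hc.of_isometry_comp B⟩

/-- Admissibility is invariant under relabelling by a permutation. [folklore] -/
theorem Admissible.comp_perm {t : Fin P.n → E3} (ht : P.Admissible t) (σ : Equiv.Perm (Fin P.n)) :
    P.Admissible (t ∘ σ) where
  inj := ht.inj.comp σ.injective
  norm_lo k := ht.norm_lo (σ k)
  norm_hi k := ht.norm_hi (σ k)
  dist_lo k l hkl := ht.dist_lo (σ k) (σ l) (fun h => hkl (σ.injective h))
  dist_alt k l hkl := ht.dist_alt (σ k) (σ l) (fun h => hkl (σ.injective h))

/-- Admissibility is invariant under linear isometries. [folklore] -/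
theorem Admissible.isometry_comp {t : Fin P.n → E3} (ht : P.Admissible t) (A : E3 ≃ₗᵢ[ℝ] E3) :
    P.Admissible fun k => A (t k) where
  inj := A.injective.comp ht.inj
  norm_lo k := by rw [A.norm_map]; exact ht.norm_lo k
  norm_hi k := by rw [A.norm_map]; exact ht.norm_hi k
  dist_lo k l hkl := by rw [A.dist_map]; exact ht.dist_lo k l hkl
  dist_alt k l hkl := by rw [A.dist_map]; exact ht.dist_alt k l hkl

/-- `Sat` is invariant under linear isometries. [folklore] -/
theorem sat_isometry_comp {S : List Constraint} {t : Fin P.n → E3} (hS : P.Sat S t)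
    (A : E3 ≃ₗᵢ[ℝ] E3) : P.Sat S fun k => A (t k) := by
  intro c hc hk hl
  have h := hS c hc hk hl
  simp only [A.dist_map]
  exact h

/-- **Rule `ref`**: an established claim, relabelled, implies every claim with more
constraints. [folklore] -/
theorem claim_of_relabel {Q : P.Patterns} {S₀ S : List Constraint} {π : List ℕ}
    (hπ : permOK P.n π = true) (hsub : ∀ c ∈ relabel π S₀, c ∈ S) (h0 : P.Claim Q S₀) :
    P.Claim Q S := by
  refine claim_mono hsub ?_
  intro t ht hS
  set σ : Equiv.Perm (Fin P.n) := permOf hπ with hσ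
  have hgood : P.Good Q (t ∘ σ) := by
    refine h0 (t ∘ σ) (ht.comp_perm σ) ?_
    intro c hc hk hl
    have hmem : (papp π c.1, papp π c.2.1, c.2.2) ∈ relabel π S₀ :=
      List.mem_map.2 ⟨c, hc, rfl⟩
    have h := hS _ hmem (papp_lt hπ hk) (papp_lt hπ hl)
    simpa [Function.comp, hσ, permOf] using h
  exact good_of_comp_perm σ hgood

/-- Coordinates of the root box below `3n`. [folklore] -/
theorem rootBox_ivl {m : ℕ} (hm : m < 3 * P.n) : P.rootBox.ivl m = P.rootIvl m := by
  unfold rootBox Box.ivl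
  rw [List.getD_eq_getElem _ _ (by simpa using hm), List.getElem_map, List.getElem_range]

/-- Coordinates of the root box from `3n` on. [folklore] -/
theorem rootBox_ivl_of_le {m : ℕ} (hm : 3 * P.n ≤ m) : P.rootBox.ivl m = (0, 0) := by
  unfold rootBox Box.ivl
  rw [List.getD_eq_default _ _ (by simpa using hm)]

/-- **A framed configuration lies in the root box.** [folklore] -/
theorem mem_rootBox {t : Fin P.n → E3} (hn : 3 ≤ P.n) (hnorm : ∀ k, ‖t k‖ ≤ (P.rhi : ℝ))
    (hlo : (P.rlo : ℝ) ≤ ‖t ⟨0, by omega⟩‖)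
    (h00 : t ⟨0, by omega⟩ 0 = 0) (h01 : t ⟨0, by omega⟩ 1 = 0)
    (h02 : t ⟨0, by omega⟩ 2 = ‖t ⟨0, by omega⟩‖)
    (h11 : t ⟨1, by omega⟩ 1 = 0) (h10 : 0 ≤ t ⟨1, by omega⟩ 0) (h21 : 0 ≤ t ⟨2, by omega⟩ 1) :
    P.rootBox.mem (flat t) := by
  have h0n : 0 < P.n := by omega
  have h1n : 1 < P.n := by omega
  have h2n : 2 < P.n := by omega
  intro m
  by_cases hm : m < 3 * P.n
  · obtain ⟨k, i, rfl⟩ : ∃ (k : Fin P.n) (i : Fin 3), m = 3 * k + i :=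
      ⟨⟨m / 3, by omega⟩, ⟨m % 3, by omega⟩, by simp only; omega⟩
    rw [rootBox_ivl hm, flat_apply]
    have habs : |t k i| ≤ ‖t k‖ := by simpa [Real.norm_eq_abs] using PiLp.norm_apply_le (t k) i
    have hb := abs_le.1 (habs.trans (hnorm k))
    have hkv := k.2
    have hiv := i.2
    unfold rootIvl
    split_ifs with h1 h2 h3
    · dsimp only
      push_cast
      suffices t k i = 0 by simp [this]
      rcases h1 with h | h | h
      · have hk : k = ⟨0, h0n⟩ := Fin.ext (by simp only; omega)
        have hi : i = 0 := Fin.ext (by simp only [Fin.val_zero]; omega)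
        rw [hk, hi]; exact h00
      · have hk : k = ⟨0, h0n⟩ := Fin.ext (by simp only; omega)
        have hi : i = 1 := Fin.ext (by simp only [Fin.val_one]; omega)
        rw [hk, hi]; exact h01
      · have hk : k = ⟨1, h1n⟩ := Fin.ext (by simp only; omega)
        have hi : i = 1 := Fin.ext (by simp only [Fin.val_one]; omega)
        rw [hk, hi]; exact h11
    · dsimp only
      have hk : k = ⟨0, h0n⟩ := Fin.ext (by simp only; omega)
      have hi : i = 2 := Fin.ext (by simp only [Fin.val_two]; omega)
      rw [hk, hi, h02]
      exact ⟨hlo, hnorm _⟩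
    · dsimp only
      push_cast
      rcases h3 with h | h
      · have hk : k = ⟨1, h1n⟩ := Fin.ext (by simp only; omega)
        have hi : i = 0 := Fin.ext (by simp only [Fin.val_zero]; omega)
        refine ⟨?_, hb.2⟩
        rw [hk, hi]; exact h10
      · have hk : k = ⟨2, h2n⟩ := Fin.ext (by simp only; omega)
        have hi : i = 1 := Fin.ext (by simp only [Fin.val_one]; omega)
        refine ⟨?_, hb.2⟩
        rw [hk, hi]; exact h21
    · dsimp only
      push_cast
      exact hb
  · rw [rootBox_ivl_of_le (not_lt.1 hm)]
    have : flat t m = 0 := by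
      unfold flat
      rw [dif_neg (by omega)]
    simp [this]

/-- **Rule `frame`**: the claim of the root box implies the frame-free claim. [folklore] -/
theorem claim_of_fclaim_rootBox {Q : P.Patterns} {S : List Constraint} (hP : P.okB = true)
    (h : P.FClaim Q S P.rootBox) : P.Claim Q S := by
  obtain ⟨hrlo, -, -, -, -, hn⟩ := okB_iff.1 hP
  intro t ht hS
  obtain ⟨A, h00, h01, h02, h11, h10, h21⟩ :=
    exists_frame t ⟨0, by omega⟩ ⟨1, by omega⟩ ⟨2, by omega⟩
  have hA := ht.isometry_comp A
  refine good_of_isometry_comp A (h _ hA (sat_isometry_comp hS A) ?_)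
  refine mem_rootBox hn hA.norm_hi (hA.norm_lo _) h00 h01 ?_ h11 h10 h21
  rw [h02, A.norm_map]

/-- **Rule `split`.** [folklore] -/
theorem fclaim_split {Q : P.Patterns} {S : List Constraint} {B : Box} (axis : ℕ) (cut : ℚ)
    (h₁ : P.FClaim Q S (B.split axis cut).1) (h₂ : P.FClaim Q S (B.split axis cut).2) :
    P.FClaim Q S B := by
  intro t ht hS hB
  rcases Box.mem_split hB axis cut with h | h
  · exact h₁ t ht hS h
  · exact h₂ t ht hS h

/-- **Rule `empty`**: an accepted exclusion witness leaves no admissible configuration in the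
box (so the claim holds vacuously). [cite: Moore1966, Theorem 3.1, §4.4] -/
theorem fclaim_of_witness {Q : P.Patterns} {S : List Constraint} {B : Box} {w : Witness}
    (hP : P.okB = true) (hw : P.witnessOK S B w = true) : P.FClaim Q S B := by
  obtain ⟨hrlo, hdlo, hgap, -, -, -⟩ := okB_iff.1 hP
  intro t ht hS hB
  exfalso
  cases w with
  | void a =>
    simp only [witnessOK, decide_eq_true_eq] at hw
    have h := hB a
    have h' : ((B.ivl a).1 : ℝ) ≤ (B.ivl a).2 := h.1.trans h.2
    exact absurd (by exact_mod_cast h') (not_le.2 hw)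
  | normLo k =>
    simp only [witnessOK, Bool.and_eq_true, decide_eq_true_eq] at hw
    obtain ⟨hk, hlt⟩ := hw
    have hm := (mem_ratCast_iff.1 (norm_sq_mem hB ⟨k, hk⟩)).2
    have hlt' : (((sqNormIv B k).snd : ℚ) : ℝ) < (P.rlo : ℝ) ^ 2 := by exact_mod_cast hlt
    have h1 := pow_le_pow_left₀ (by exact_mod_cast hrlo) (ht.norm_lo ⟨k, hk⟩) 2
    linarith
  | normHi k =>
    simp only [witnessOK, Bool.and_eq_true, decide_eq_true_eq] at hw
    obtain ⟨hk, hlt⟩ := hw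
    have hm := (mem_ratCast_iff.1 (norm_sq_mem hB ⟨k, hk⟩)).1
    have hlt' : (P.rhi : ℝ) ^ 2 < (((sqNormIv B k).fst : ℚ) : ℝ) := by exact_mod_cast hlt
    have h1 := pow_le_pow_left₀ (norm_nonneg _) (ht.norm_hi ⟨k, hk⟩) 2
    linarith
  | distLo k l =>
    simp only [witnessOK, Bool.and_eq_true, decide_eq_true_eq, Bool.not_eq_true',
      beq_eq_false_iff_ne, ne_eq] at hw
    obtain ⟨⟨⟨hk, hl⟩, hkl⟩, hlt⟩ := hw
    have hm := (mem_ratCast_iff.1 (dist_sq_mem hB ⟨k, hk⟩ ⟨l, hl⟩)).2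
    have hlt' : (((sqDistIv B k l).snd : ℚ) : ℝ) < (P.dlo : ℝ) ^ 2 := by exact_mod_cast hlt
    have h1 := pow_le_pow_left₀ (by exact_mod_cast hdlo)
      (ht.dist_lo ⟨k, hk⟩ ⟨l, hl⟩ (fun h => hkl (congrArg Fin.val h))) 2
    linarith
  | gap k l =>
    simp only [witnessOK, Bool.and_eq_true, decide_eq_true_eq, Bool.not_eq_true',
      beq_eq_false_iff_ne, ne_eq] at hw
    obtain ⟨⟨⟨⟨hk, hl⟩, hkl⟩, hlt₁⟩, hlt₂⟩ := hw
    have hm := mem_ratCast_iff.1 (dist_sq_mem hB ⟨k, hk⟩ ⟨l, hl⟩)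
    have hlt₁' : (P.dhi : ℝ) ^ 2 < (((sqDistIv B k l).fst : ℚ) : ℝ) := by exact_mod_cast hlt₁
    have hlt₂' : (((sqDistIv B k l).snd : ℚ) : ℝ) < (P.gap : ℝ) ^ 2 := by exact_mod_cast hlt₂
    rcases ht.dist_alt ⟨k, hk⟩ ⟨l, hl⟩ (fun h => hkl (congrArg Fin.val h)) with h | h
    · have h1 := pow_le_pow_left₀ dist_nonneg h 2
      linarith [hm.1]
    · have h1 := pow_le_pow_left₀ (by exact_mod_cast hgap) h 2
      linarith [hm.2]
  | bondHi k l =>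
    simp only [witnessOK, Bool.and_eq_true, decide_eq_true_eq] at hw
    obtain ⟨⟨⟨hk, hl⟩, hmem⟩, hlt⟩ := hw
    have hm := (mem_ratCast_iff.1 (dist_sq_mem hB ⟨k, hk⟩ ⟨l, hl⟩)).1
    have hlt' : (P.dhi : ℝ) ^ 2 < (((sqDistIv B k l).fst : ℚ) : ℝ) := by exact_mod_cast hlt
    have h := ((hS _ hmem hk hl).1 rfl)
    have h1 := pow_le_pow_left₀ dist_nonneg h 2
    linarith
  | farLo k l =>
    simp only [witnessOK, Bool.and_eq_true, decide_eq_true_eq] at hw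
    obtain ⟨⟨⟨hk, hl⟩, hmem⟩, hlt⟩ := hw
    have hm := (mem_ratCast_iff.1 (dist_sq_mem hB ⟨k, hk⟩ ⟨l, hl⟩)).2
    have hlt' : (((sqDistIv B k l).snd : ℚ) : ℝ) < (P.gap : ℝ) ^ 2 := by exact_mod_cast hlt
    have h := ((hS _ hmem hk hl).2 rfl)
    have h1 := pow_le_pow_left₀ (by exact_mod_cast hgap) h 2
    linarith

/-- **Rule `accept`**: every configuration in an accepted box is `eta`-close to the pattern.
[cite: Moore1966, Theorem 3.1] -/
theorem fclaim_of_accept {Q : P.Patterns} {S : List Constraint} {B : Box} {pat : ℕ}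
    {M : List ℚ} {σ : List ℕ} (hP : P.okB = true) (hacc : P.acceptOK B pat M σ = true) :
    P.FClaim Q S B := by
  obtain ⟨-, -, -, heps, hee, -⟩ := okB_iff.1 hP
  simp only [acceptOK, Bool.and_eq_true, decide_eq_true_eq, List.all_eq_true, List.mem_range] at hacc
  obtain ⟨⟨⟨hpat, hM⟩, hσ⟩, hall⟩ := hacc
  intro t ht hS hB
  have hpat' : pat < Q.pts.length := Q.len_eq ▸ hpat
  refine ⟨pat, hpat', rotIso M hM, permOf hσ, fun k => ?_⟩
  set a : ℚ × ℚ × ℚ := P.anchor pat (papp σ k) with ha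
  have hk := hall k k.2
  rw [← ha] at hk
  -- distance to the placed anchor
  have hm := (mem_ratCast_iff.1 (dist_pt_sq_mem hB k (rotQ M a))).2
  have hk' : (((sqDistPtIv B k (rotQ M a)).snd : ℚ) : ℝ) ≤ ((P.eta : ℝ) - P.eps) ^ 2 := by
    exact_mod_cast hk
  have hee' : (0 : ℝ) ≤ P.eta - P.eps := by exact_mod_cast sub_nonneg.2 hee
  have h1 : dist (t k) (qpt (rotQ M a)) ≤ P.eta - P.eps := by
    apply (sq_le_sq₀ dist_nonneg hee').1
    linarith
  -- anchor to pattern point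
  have h2 : dist (rotIso M hM (qpt a)) (rotIso M hM (Q.pts[pat] (permOf hσ k))) ≤ P.eps := by
    rw [LinearIsometry.dist_map, dist_comm]
    exact Q.close pat hpat' _
  have h3 : rotIso M hM (qpt a) = qpt (rotQ M a) := by simp [rotLin_qpt]
  calc dist (t k) (rotIso M hM (Q.pts[pat] (permOf hσ k)))
      ≤ dist (t k) (rotIso M hM (qpt a)) + dist (rotIso M hM (qpt a)) (rotIso M hM (Q.pts[pat] (permOf hσ k))) :=
        dist_triangle _ _ _
    _ ≤ (P.eta - P.eps) + P.eps := by rw [h3] at h2 ⊢; exact add_le_add h1 h2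
    _ = P.eta := by ring

end Spec

/-! ### Soundness of the checkers -/

/-- A frame-free claim implies the claim of every node with the same constraints. [folklore] -/
theorem Spec.nodeClaim_of_claim {P : Spec} {Q : P.Patterns} {S : List Constraint}
    (h : P.Claim Q S) : ∀ ob : Option Box, P.NodeClaim Q S ob
  | none => h
  | some _ => fun t ht hS _ => h t ht hS

/-- **Soundness of the tree checker**: with every claim of the context established, an accepted
tree establishes the claim of its node. [folklore] -/
theorem Tree.check_sound {P : Spec} (Q : P.Patterns) (hP : P.okB = true)
    (ctx : Array (List Constraint)) (hctx : ∀ (j : ℕ) (hj : j < ctx.size), P.Claim Q ctx[j]) :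
    ∀ (tr : Tree) (S : List Constraint) (ob : Option Box),
      tr.check P ctx S ob = true → P.NodeClaim Q S ob
  | .case k l tb tf, S, ob, h => by
    simp only [Tree.check, Bool.and_eq_true, decide_eq_true_eq, Bool.not_eq_true',
      beq_eq_false_iff_ne, ne_eq] at h
    obtain ⟨⟨⟨⟨hk, hl⟩, hkl⟩, hb⟩, hf⟩ := h
    exact Spec.nodeClaim_case hk hl hkl (Tree.check_sound Q hP ctx hctx tb _ _ hb)
      (Tree.check_sound Q hP ctx hctx tf _ _ hf)
  | .ref π j, S, ob, h => by
    simp only [Tree.check] at h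
    split at h
    · exact absurd h Bool.false_ne_true
    · rename_i S₀ hS₀
      obtain ⟨hj, rfl⟩ := Array.getElem?_eq_some_iff.1 hS₀
      simp only [Bool.and_eq_true, List.all_eq_true, decide_eq_true_eq] at h
      exact Spec.nodeClaim_of_claim (Spec.claim_of_relabel h.1 h.2 (hctx j hj)) ob
  | .frame sub, S, none, h =>
    Spec.claim_of_fclaim_rootBox hP (Tree.check_sound Q hP ctx hctx sub S (some P.rootBox) h)
  | .frame _, _, some _, h => absurd h (by simp [Tree.check])
  | .split axis cut lo hi, S, some B, h => by
    simp only [Tree.check, Bool.and_eq_true] at h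
    exact Spec.fclaim_split axis cut (Tree.check_sound Q hP ctx hctx lo S _ h.1)
      (Tree.check_sound Q hP ctx hctx hi S _ h.2)
  | .split _ _ _ _, _, none, h => absurd h (by simp [Tree.check])
  | .empty w, S, some B, h => Spec.fclaim_of_witness hP h
  | .empty _, _, none, h => absurd h (by simp [Tree.check])
  | .accept pat M σ, S, some B, h => Spec.fclaim_of_accept hP h
  | .accept _ _ _, _, none, h => absurd h (by simp [Tree.check])

/-- **Soundness of `Census.checkFrom`**: starting from an established context, every entry of
an accepted census is established. This is also the COMPOSITION rule for certificates split
over several files: the context lists the constraint lists proved elsewhere. [folklore] -/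
theorem Census.checkFrom_sound {P : Spec} (Q : P.Patterns) (hP : P.okB = true) :
    ∀ (C : Census) (ctx : Array (List Constraint)),
      (∀ (j : ℕ) (hj : j < ctx.size), P.Claim Q ctx[j]) →
      Census.checkFrom P ctx C = true → ∀ e ∈ C, P.Claim Q e.1
  | [], _, _, _ => by simp
  | (S, tr) :: rest, ctx, hctx, h => by
    simp only [Census.checkFrom, Bool.and_eq_true] at h
    obtain ⟨h1, h2⟩ := h
    have hS : P.Claim Q S := Tree.check_sound Q hP ctx hctx tr S none h1
    have hctx' : ∀ (j : ℕ) (hj : j < (ctx.push S).size), P.Claim Q (ctx.push S)[j] := by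
      intro j hj
      rw [Array.getElem_push]
      split
      · exact hctx j _
      · exact hS
    intro e he
    rcases List.mem_cons.1 he with rfl | he
    · exact hS
    · exact Census.checkFrom_sound Q hP rest (ctx.push S) hctx' h2 e he

/-- **Soundness of the census checker**: an accepted census establishes the unconditional
claim — every admissible configuration is `eta`-close to one of the patterns. [folklore] -/
theorem Census.check_sound {P : Spec} (Q : P.Patterns) (C : Census)
    (h : Census.check P C = true) : P.Claim Q [] := by
  simp only [Census.check, Bool.and_eq_true, List.any_eq_true] at h
  obtain ⟨⟨hP, hC⟩, e, he, hnil⟩ := h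
  have h' := Census.checkFrom_sound Q hP C #[] (fun j hj => absurd hj (by simp)) hC e he
  rw [List.isEmpty_iff] at hnil
  rwa [hnil] at h'

/-- The unconditional claim, unfolded: every admissible tuple is good. [folklore] -/
theorem Spec.good_of_claim_nil {P : Spec} {Q : P.Patterns} (h : P.Claim Q [])
    (t : Fin P.n → E3) (ht : P.Admissible t) : P.Good Q t :=
  h t ht (fun c hc => by simp at hc)


/-- The context array of a census: its constraint lists, in order. [folklore] -/
def Census.ctx (C : Census) : Array (List Constraint) := (C.map Prod.fst).toArray

/-- Established entries give an established context. [folklore] -/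
theorem Census.claim_ctx {P : Spec} {Q : P.Patterns} {C : Census} (h : ∀ e ∈ C, P.Claim Q e.1) :
    ∀ (j : ℕ) (hj : j < C.ctx.size), P.Claim Q C.ctx[j] := by
  intro j hj
  simp only [Census.ctx, List.getElem_toArray, List.getElem_map]
  exact h _ (List.getElem_mem _)

/-- **Composition of certificates**: if the entries of `C₀` are established (e.g. in earlier
files) and `C` checks against the context `C₀.ctx`, then all entries of `C₀ ++ C` are
established. Chain: `part₂ := claims_append_of_checkFrom Q hP C₁ C₂ part₁ (by native_decide)`,
`part₃ := claims_append_of_checkFrom Q hP (C₁ ++ C₂) C₃ part₂ (by native_decide)`, …. [folklore] -/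
theorem Census.claims_append_of_checkFrom {P : Spec} (Q : P.Patterns) (hP : P.okB = true)
    (C₀ C : Census) (h₀ : ∀ e ∈ C₀, P.Claim Q e.1) (h : Census.checkFrom P C₀.ctx C = true) :
    ∀ e ∈ C₀ ++ C, P.Claim Q e.1 := by
  intro e he
  rcases List.mem_append.1 he with he | he
  · exact h₀ e he
  · exact Census.checkFrom_sound Q hP C C₀.ctx (Census.claim_ctx h₀) h e he

/-- The empty census is (vacuously) established — the start of a chain. [folklore] -/
theorem Census.claims_nil {P : Spec} (Q : P.Patterns) : ∀ e ∈ ([] : Census), P.Claim Q e.1 := by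
  simp

/-- Extracting the unconditional claim from established entries. [folklore] -/
theorem Spec.claim_nil_of_claims {P : Spec} {Q : P.Patterns} {C : Census}
    (h : ∀ e ∈ C, P.Claim Q e.1) (hnil : (C.any fun e => e.1.isEmpty) = true) : P.Claim Q [] := by
  obtain ⟨e, he, he'⟩ := List.any_eq_true.1 hnil
  have h' := h e he
  rw [List.isEmpty_iff] at he'
  rwa [he'] at h'


/-! ### Injectivity of patterns from anchor separation -/

/-- A pattern whose anchors pass the separation test is an injective tuple. [folklore] -/
theorem Spec.Patterns.injective_of_sep {P : Spec} (Q : P.Patterns) {i : ℕ} (hi : i < Q.pts.length)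
    (h : P.anchorsSepB i = true) : Function.Injective Q.pts[i] := by
  intro j k hjk
  by_contra hne
  have h' : ∀ j ∈ List.range P.n, ∀ k ∈ List.range P.n,
      j = k ∨ (2 * P.eps) ^ 2 < sqDistQ (P.anchor i j) (P.anchor i k) := by
    simpa [Spec.anchorsSepB, List.all_eq_true] using h
  rcases h' j (List.mem_range.2 j.2) k (List.mem_range.2 k.2) with hjk' | hlt
  · exact hne (Fin.ext hjk')
  have h1 := Q.close i hi j
  have h2 := Q.close i hi k
  rw [hjk] at h1
  have hd : dist (qpt (P.anchor i j)) (qpt (P.anchor i k)) ≤ 2 * P.eps := by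
    calc dist (qpt (P.anchor i j)) (qpt (P.anchor i k))
        ≤ dist (qpt (P.anchor i j)) (Q.pts[i] k) + dist (Q.pts[i] k) (qpt (P.anchor i k)) :=
          dist_triangle _ _ _
      _ ≤ P.eps + P.eps := add_le_add (by rw [dist_comm]; exact h1) h2
      _ = 2 * P.eps := by ring
  have hlt' : (2 * (P.eps : ℝ)) ^ 2 < dist (qpt (P.anchor i j)) (qpt (P.anchor i k)) ^ 2 := by
    rw [dist_qpt_sq]; exact_mod_cast hlt
  have h0 : 0 ≤ 2 * (P.eps : ℝ) := dist_nonneg.trans hd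
  nlinarith [pow_le_pow_left₀ dist_nonneg hd 2]


end ShellCensus

end Literature.Geometry.DiscreteGeometry

end
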